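import Summits.QuantumFields.YangMills.Theorems.BalabanUVNodesN21ThresholdMixtureTransfer

/-!
# YM-DAG node N21 (= NE7c) — THE THRESHOLD MIXTURE, PART 19: PRICING FILE 17's λ-UNIFORMITY BINDERS — the WEIGHT clause is print at ONE lowered corner
# (for an UP-SET bad class the sharp bad-class event is ANTITONE in the threshold vector, so NE7b at the bottom corner `(1−κ)θ` gives NE7b on the whole
# box: the `hbadA`∕`hbadB` binders of 17's ★★), and the CORE constant may oscillate over the box by a summable `η_K` (the width absorbs it)

Track A of `YM-PLAN.md` (cell `pub-ymgap`, HUMAN RULING D-0062), node **N21**; R141 (C) fan-out seat `pub-ymgap-dag-n21-e` (s3 = ALTERNATIVE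
CURRENCY), generation 7, file 19.  Lane K3⁗ `SpineGivenEndpointR13Sep` = stmt-QuantumFields-20292 (`--kind proof --supports … --as helper`).
Imports file 17 `…N21ThresholdMixtureTransfer` (p506004) only.

WHY THIS FILE.  File 17 located the mixture road's cost as λ-UNIFORMITY over the threshold box of (i) N20's sharp bad-class bound `W_K` and (ii) the core
constant `c_K`.  For (i) the uniformity is NOT a new estimate: lowering a threshold turns small-field slots into large-field slots, never the converse;
if the bad class is an UP-SET for slot-wise largeness (a term with MORE large-field slots than a bad term is bad — King's «some large-field structure near
the end», [King1986] (3.10)–(3.11), shape only), then the bad-class EVENT grows as the threshold vector decreases, while the total weight is threshold-free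
((E1) at every threshold vector).  Hence the sharp relative bad-class bound at the BOTTOM CORNER of the box (all thresholds lowered by the factor `1 − κ`
— ONE sharp procedure of print at lowered thresholds, the located robustness (L1): [Balaban1989LargeFieldI] p. 181 ladder slack, [Balaban1989LargeFieldII]
p. 383 exponent margin) implies the bound at EVERY threshold vector of the box with the SAME `W_K` — exactly file 17's binders `hbadA`∕`hbadB`.

WHAT IS TYPED AND PROVED (all [folklore]: order bookkeeping, `Finset.sum_ite_eq`, `integral_mono`).
* §1 `classBound_of_corner` (abstract: a class sum dominated along the box by its value at a corner `λ₀`, totals constant along the box, the bound at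
  `λ₀` ⇒ the bound on the box) · `classBound_ae_of_corner` (the `P`-a.e. form feeding file 17).
* §2 LABELLED SHARP WEIGHTS `Xs λ τ = ∫ 1[lab_λ(U) = τ]·R(U) dμ` (`R ≥ 0` the threshold-free remainder, `lab_λ` the label of the configuration at threshold
  vector `λ`): `sum_ite_label_eq` · `sum_labelWeight_eq` (a class sum is the integral of `R` over the class EVENT) · `integral_labelClass_mono` (event
  inclusion ⇒ class-sum order) · `integral_labelTotal_eq` (the total over all labels is `∫ R dμ`, threshold-free — (E1) sharp at every `λ`).
* §3 SLOT-WISE LARGENESS: `lab_λ(U) := (i ↦ [θ_i·λ_i ≤ u_i(U)])` (large at slot `i`), an UP-SET `Bad` (`hup`); `largeLabel_anti` (`λ ≤ λ′` coordinatewise,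
  `0 ≤ θ` ⇒ `lab_{λ′} ≤ lab_λ`), `badEvent_antitone` (`{lab_{λ′} ∈ Bad} ⊆ {lab_λ ∈ Bad}`), ★ `sharpBadBound_of_corner` (NE7b sharp at the corner `λ₀ ≤ λ` ⇒
  NE7b sharp at `λ`, same `W`) and ★ `sharpBadBound_ae_of_corner` (the a.e. form on any measure of threshold vectors carried by `{λ | λ₀ ≤ λ}`) ·
  `ae_corner_le_boxPi` (the interval box of files 10a∕12 IS so carried).
* §4 `sandwich_of_osc` · ★ `core_of_average_osc` (file 17's `core` binder with the sharp constant only within `η_K` of `c_K` a.e.: the averaged cores are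
  sandwiched with `c_K` and width `vol·(δ_K + η_K∕vol)` — a SUMMABLE oscillation of the core constant over the box is free).

HONEST FRAMING.  Order bookkeeping; the up-set property of the bad class (King's shape; the tree's `T4PeierlsDomination.PeierlsDom` types each bad term's
charge of old pending large-field structures as non-empty — an up-set by design, not by proof), the labelled representation with a label-COMMON remainder `R` (the term family as a pure decomposition of unity of
ONE positive functional — [Balaban1989LargeFieldI] p. 193 «they change only the representation of this density»; with TERM-DEPENDENT remainders `R_τ`, as in
the K5 readings' `RA K t τ`, the event monotonicity of §3 is a separate input) and NE7b at the lowered corner are HYPOTHESES (N20 ∕ NODE O); the core constant (ii) is not monotone — §4 prices it as «uniform up to a summable oscillation», nothing more; nothing of Bałaban's asserted; NE7c ∕ NE7b NOT PRINTED for d = 4 ∕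
NOT proved; N21 NOT discharged; counts unmoved (typed 28∕28 · discharged 5∕27, A 5∕28); one finite 𝕋⁴ at fixed ε — NOT ℝ⁴ ∕ OS ∕ mass gap ∕ Clay.
No `sorry`∕`axiom`∕`def`∕`instance`∕`notation`.
-/

noncomputable section

open MeasureTheory Set
open scoped BigOperators ENNReal

namespace Summit.QuantumFields.YangMills.Theorems.N21ThresholdMixtureTransferCorner

/-! ## §1  A class bound at a dominating corner passes to the whole box -/

section Corner

variable {Λ : Type*} {ι : Type*}

/-- **CORNER ⇒ BOX** (abstract).  If along a set `S` of threshold vectors the class sum is dominated by its value at `λ₀` (`hmono`), the total is constant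
(`htot`, (E1) at every threshold vector), and the relative class bound holds at `λ₀`, then it holds on `S` (no sign condition on `w`):
`Σ_C Xs λ ≤ Σ_C Xs λ₀ ≤ w·Σ_T Xs λ₀ = w·Σ_T Xs λ`. [folklore] -/
theorem classBound_of_corner (S : Set Λ) (l₀ : Λ) (C T : Finset ι) (Xs : Λ → ι → ℝ) (w : ℝ)
    (hmono : ∀ l ∈ S, ∑ τ ∈ C, Xs l τ ≤ ∑ τ ∈ C, Xs l₀ τ) (htot : ∀ l ∈ S, ∑ τ ∈ T, Xs l τ = ∑ τ ∈ T, Xs l₀ τ)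
    (h0 : ∑ τ ∈ C, Xs l₀ τ ≤ w * ∑ τ ∈ T, Xs l₀ τ) :
    ∀ l ∈ S, ∑ τ ∈ C, Xs l τ ≤ w * ∑ τ ∈ T, Xs l τ := fun l hl => by
  rw [htot l hl]
  exact (hmono l hl).trans h0

/-- The `P`-almost-everywhere form: for a measure of threshold vectors carried by `S` (`∀ᵐ λ ∂P, λ ∈ S`) the sharp bound holds `P`-a.e. — the binder
`hbadA`∕`hbadB` of file 17's `hybridNE7_of_average_of_shellWeightBound`. [folklore] -/
theorem classBound_ae_of_corner [MeasurableSpace Λ] {P : Measure Λ} (S : Set Λ) (l₀ : Λ) (C T : Finset ι) (Xs : Λ → ι → ℝ)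
    (w : ℝ) (hS : ∀ᵐ l ∂P, l ∈ S)
    (hmono : ∀ l ∈ S, ∑ τ ∈ C, Xs l τ ≤ ∑ τ ∈ C, Xs l₀ τ) (htot : ∀ l ∈ S, ∑ τ ∈ T, Xs l τ = ∑ τ ∈ T, Xs l₀ τ)
    (h0 : ∑ τ ∈ C, Xs l₀ τ ≤ w * ∑ τ ∈ T, Xs l₀ τ) :
    ∀ᵐ l ∂P, ∑ τ ∈ C, Xs l τ ≤ w * ∑ τ ∈ T, Xs l τ :=
  hS.mono fun l hl => classBound_of_corner S l₀ C T Xs w hmono htot h0 l hl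

end Corner

/-! ## §2  Labelled sharp weights: class sums are integrals over class events -/

section Labelled

variable {Ω : Type*} [MeasurableSpace Ω] {μ : Measure Ω} {L : Type*} [DecidableEq L]

/-- Pointwise: summing the label indicator over a class gives the class-event indicator, `Σ_{τ ∈ C} 1[lab U = τ]·R U = 1[lab U ∈ C]·R U`. [folklore] -/
theorem sum_ite_label_eq (C : Finset L) (a : L) (r : ℝ) :
    ∑ τ ∈ C, (if a = τ then r else 0) = if a ∈ C then r else 0 :=
  Finset.sum_ite_eq C a fun _ => r

/-- **A CLASS SUM OF LABELLED SHARP WEIGHTS IS THE INTEGRAL OF THE REMAINDER OVER THE CLASS EVENT.**  With `Xs τ = ∫ 1[lab U = τ]·R U dμ` (pinning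
`hXs`; ONE label-common remainder `R` — a pure decomposition of unity of the positive functional `R dμ`) and every piece integrable:
`Σ_{τ ∈ C} Xs τ = ∫ 1[lab U ∈ C]·R U dμ`. [folklore] -/
theorem sum_labelWeight_eq (lab : Ω → L) (R : Ω → ℝ) (C : Finset L) (Xs : L → ℝ)
    (hXs : ∀ τ ∈ C, Xs τ = ∫ U, (if lab U = τ then R U else 0) ∂μ)
    (hint : ∀ τ ∈ C, Integrable (fun U => if lab U = τ then R U else 0) μ) :
    ∑ τ ∈ C, Xs τ = ∫ U, (if lab U ∈ C then R U else 0) ∂μ := by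
  rw [Finset.sum_congr rfl hXs, ← integral_finsetSum C hint]
  exact integral_congr_ae (ae_of_all _ fun U => sum_ite_label_eq C (lab U) (R U))

/-- **EVENT INCLUSION ⇒ CLASS-SUM ORDER** for a nonnegative remainder: if `{lab U ∈ C} ⊆ {lab′ U ∈ C}` then `∫ 1[lab ∈ C]·R ≤ ∫ 1[lab′ ∈ C]·R`.
[folklore] -/
theorem integral_labelClass_mono (lab lab' : Ω → L) (R : Ω → ℝ) (C : Finset L) (hR : ∀ U, 0 ≤ R U)
    (hsub : ∀ U, lab U ∈ C → lab' U ∈ C)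
    (hint : Integrable (fun U => if lab U ∈ C then R U else 0) μ)
    (hint' : Integrable (fun U => if lab' U ∈ C then R U else 0) μ) :
    ∫ U, (if lab U ∈ C then R U else 0) ∂μ ≤ ∫ U, (if lab' U ∈ C then R U else 0) ∂μ := by
  refine integral_mono hint hint' fun U => ?_
  by_cases h : lab U ∈ C
  · simp only [h, hsub U h, if_true, le_refl]
  · simp only [h, if_false]
    split_ifs
    · exact hR U
    · exact le_rfl

/-- **THE TOTAL IS THRESHOLD-FREE** ((E1) sharp at every threshold vector): over ALL labels the class event is everything, `∫ 1[lab U ∈ univ]·R = ∫ R`.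
[folklore] -/
theorem integral_labelTotal_eq [Fintype L] (lab : Ω → L) (R : Ω → ℝ) :
    ∫ U, (if lab U ∈ (Finset.univ : Finset L) then R U else 0) ∂μ = ∫ U, R U ∂μ :=
  integral_congr_ae (ae_of_all _ fun U => by simp only [Finset.mem_univ, if_true])

end Labelled

/-! ## §3  Slot-wise largeness: lowering thresholds enlarges an up-set bad class; NE7b at the lowered corner ⇒ NE7b on the box -/

section Slots

variable {Ω : Type*} {σ : Type*}

/-- **LOWER THRESHOLDS ⇒ MORE LARGE SLOTS.**  The label «large at slot `i`» `[θ_i·λ_i ≤ u_i(U)]` is ANTITONE in the multiplier vector: for `λ ≤ λ′`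
coordinatewise and `0 ≤ θ`, every slot large at `λ′` is large at `λ` — `lab_{λ′} ≤ lab_λ` in the product order of `σ → Bool`. [folklore] -/
theorem largeLabel_anti (θ : σ → ℝ) (hθ : ∀ i, 0 ≤ θ i) (u : σ → Ω → ℝ) {l l' : σ → ℝ} (hll : l ≤ l') (U : Ω) :
    (fun i => decide (θ i * l' i ≤ u i U)) ≤ fun i => decide (θ i * l i ≤ u i U) := by
  intro i
  simp only [Bool.le_iff_imp, decide_eq_true_eq]
  exact fun h => (mul_le_mul_of_nonneg_left (hll i) (hθ i)).trans h

/-- **THE BAD EVENT IS ANTITONE IN THE THRESHOLD VECTOR** for an UP-SET bad class (`hup`: a label with more large slots than a bad label is bad):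
`{U | lab_{λ′}(U) ∈ Bad} ⊆ {U | lab_λ(U) ∈ Bad}` for `λ ≤ λ′`. [folklore] -/
theorem badEvent_antitone (θ : σ → ℝ) (hθ : ∀ i, 0 ≤ θ i) (u : σ → Ω → ℝ) (Bad : Finset (σ → Bool))
    (hup : ∀ a b : σ → Bool, a ≤ b → a ∈ Bad → b ∈ Bad) {l l' : σ → ℝ} (hll : l ≤ l') (U : Ω)
    (h : (fun i => decide (θ i * l' i ≤ u i U)) ∈ Bad) : (fun i => decide (θ i * l i ≤ u i U)) ∈ Bad :=
  hup _ _ (largeLabel_anti θ hθ u hll U) h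

variable [MeasurableSpace Ω] {μ : Measure Ω} [Fintype σ] [DecidableEq σ]

/-- ★ **NE7b AT THE LOWERED CORNER ⇒ NE7b AT EVERY THRESHOLD VECTOR OF THE BOX, SAME `W`.**  Labelled sharp weights
`Xs λ τ = ∫ 1[lab_λ(U) = τ]·R(U) dμ` over ALL labels `τ : σ → Bool` (pinning `hXs`, pieces integrable), `0 ≤ R` threshold-free, an UP-SET bad class, and the
sharp relative bad-class bound at the corner `λ₀`: then at every `λ ≥ λ₀` (coordinatewise — every vector of the box `[(1−κ), 1]^σ` lies above its bottom
corner) `Σ_{τ ∈ Bad} Xs λ τ ≤ W·Σ_τ Xs λ τ`.  The λ-uniformity binder of file 17's weight clause, priced as ONE sharp procedure at lowered thresholds.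
CONDITIONAL on every displayed binder (NE7b itself is N20's, NOT proved here). [cite: King1986, (3.10)–(3.11) pp.656–657 (shape of the bad class; template only)] -/
theorem sharpBadBound_of_corner (θ : σ → ℝ) (hθ : ∀ i, 0 ≤ θ i) (u : σ → Ω → ℝ) (R : Ω → ℝ) (hR : ∀ U, 0 ≤ R U)
    (Bad : Finset (σ → Bool)) (hup : ∀ a b : σ → Bool, a ≤ b → a ∈ Bad → b ∈ Bad) (Xs : (σ → ℝ) → (σ → Bool) → ℝ)
    (hXs : ∀ (l : σ → ℝ) (τ : σ → Bool), Xs l τ = ∫ U, (if (fun i => decide (θ i * l i ≤ u i U)) = τ then R U else 0) ∂μ)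
    (hint : ∀ (l : σ → ℝ) (τ : σ → Bool), Integrable (fun U => if (fun i => decide (θ i * l i ≤ u i U)) = τ then R U else 0) μ)
    (hintC : ∀ (l : σ → ℝ) (C : Finset (σ → Bool)),
      Integrable (fun U => if (fun i => decide (θ i * l i ≤ u i U)) ∈ C then R U else 0) μ)
    (l₀ : σ → ℝ) {W : ℝ} (h0 : ∑ τ ∈ Bad, Xs l₀ τ ≤ W * ∑ τ, Xs l₀ τ) {l : σ → ℝ} (hl : l₀ ≤ l) :
    ∑ τ ∈ Bad, Xs l τ ≤ W * ∑ τ, Xs l τ := by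
  refine classBound_of_corner {l | l₀ ≤ l} l₀ Bad Finset.univ Xs W (fun l' hl' => ?_) (fun l' _ => ?_) h0 l hl
  · rw [sum_labelWeight_eq _ R Bad (Xs l') (fun τ _ => hXs l' τ) (fun τ _ => hint l' τ),
      sum_labelWeight_eq _ R Bad (Xs l₀) (fun τ _ => hXs l₀ τ) (fun τ _ => hint l₀ τ)]
    exact integral_labelClass_mono _ _ R Bad hR (fun U hU => badEvent_antitone θ hθ u Bad hup hl' U hU) (hintC l' Bad)
      (hintC l₀ Bad)
  · rw [sum_labelWeight_eq _ R Finset.univ (Xs l') (fun τ _ => hXs l' τ) (fun τ _ => hint l' τ),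
      sum_labelWeight_eq _ R Finset.univ (Xs l₀) (fun τ _ => hXs l₀ τ) (fun τ _ => hint l₀ τ),
      integral_labelTotal_eq, integral_labelTotal_eq]

/-- ★ … and the `P`-a.e. form for any measure of threshold vectors carried by the box above the corner (`∀ᵐ λ ∂P, λ₀ ≤ λ` — e.g. the normalised
`Measure.pi` of `volume.restrict [(1−κ_i), 1]` with `λ₀ = (1−κ_i)_i`): the literal `hbadA`∕`hbadB` binder of file 17's ★★ at step `K`, source `t`.
[cite: King1986, (3.10)–(3.11) pp.656–657 (shape; template only)] -/
theorem sharpBadBound_ae_of_corner {P : Measure (σ → ℝ)} (θ : σ → ℝ) (hθ : ∀ i, 0 ≤ θ i) (u : σ → Ω → ℝ) (R : Ω → ℝ)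
    (hR : ∀ U, 0 ≤ R U) (Bad : Finset (σ → Bool)) (hup : ∀ a b : σ → Bool, a ≤ b → a ∈ Bad → b ∈ Bad)
    (Xs : (σ → ℝ) → (σ → Bool) → ℝ)
    (hXs : ∀ (l : σ → ℝ) (τ : σ → Bool), Xs l τ = ∫ U, (if (fun i => decide (θ i * l i ≤ u i U)) = τ then R U else 0) ∂μ)
    (hint : ∀ (l : σ → ℝ) (τ : σ → Bool), Integrable (fun U => if (fun i => decide (θ i * l i ≤ u i U)) = τ then R U else 0) μ)
    (hintC : ∀ (l : σ → ℝ) (C : Finset (σ → Bool)),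
      Integrable (fun U => if (fun i => decide (θ i * l i ≤ u i U)) ∈ C then R U else 0) μ)
    (l₀ : σ → ℝ) {W : ℝ} (h0 : ∑ τ ∈ Bad, Xs l₀ τ ≤ W * ∑ τ, Xs l₀ τ) (hP : ∀ᵐ l ∂P, l₀ ≤ l) :
    ∀ᵐ l ∂P, ∑ τ ∈ Bad, Xs l τ ≤ W * ∑ τ, Xs l τ :=
  hP.mono fun _ hl => sharpBadBound_of_corner θ hθ u R hR Bad hup Xs hXs hint hintC l₀ h0 hl

omit [MeasurableSpace Ω] [DecidableEq σ] in
/-- **THE COMMON BOX IS CARRIED BY THE CORNER's UPPER SET**: under the product of interval-restricted Lebesgue measures on `[a_i, b_i]` almost every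
multiplier vector satisfies `a ≤ l` — the `hP` binder of `sharpBadBound_ae_of_corner` for the box of files 10a∕12 (corner `a = (1 − κ_i)_i`); by file 17's
`ae_normalized_of_ae` the same holds for the NORMALISED box measure. [folklore] -/
theorem ae_corner_le_boxPi (a b : σ → ℝ) :
    ∀ᵐ l ∂(Measure.pi fun i : σ => (volume : Measure ℝ).restrict (Icc (a i) (b i))), a ≤ l := by
  rw [← Measure.restrict_pi_pi]
  filter_upwards [ae_restrict_mem (MeasurableSet.univ_pi fun i => measurableSet_Icc)] with l hl
  exact fun i => (hl i (Set.mem_univ i)).1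

end Slots

/-! ## §4  The core constant: λ-uniform UP TO A SUMMABLE OSCILLATION is enough (the width absorbs it) -/

section CoreOsc

open Summit.QuantumFields.YangMills.Theorems.N21ThresholdMixtureTransfer (core_of_average)

variable {ι : Type*} [DecidableEq ι] {Λ : ℕ → Type*} [∀ K, MeasurableSpace (Λ K)] {P : (K : ℕ) → Measure (Λ K)} {l₀ vol : ℝ}
  {T : ℕ → Finset ι} {Bad : ℕ → ℝ → Finset ι} {δ η : ℕ → ℝ}
  {As Bs shAs shBs : (K : ℕ) → Λ K → ℝ → ι → ℝ} {A B shA shB : ℕ → ℝ → ι → ℝ}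

/-- Pointwise: a two-sided sandwich with a constant `c′` within `η` of `c` and a NONNEGATIVE core is a sandwich with the constant `c` and the width
enlarged by `η`. [folklore] -/
theorem sandwich_of_osc {c c' η w x y : ℝ} (hx : 0 ≤ x) (hc : |c' - c| ≤ η)
    (h : Real.exp (c' - w) * x ≤ y ∧ y ≤ Real.exp (c' + w) * x) :
    Real.exp (c - (w + η)) * x ≤ y ∧ y ≤ Real.exp (c + (w + η)) * x := by
  obtain ⟨h1, h2⟩ := abs_sub_le_iff.1 hc
  constructor
  · exact (mul_le_mul_of_nonneg_right (Real.exp_le_exp.2 (by linarith)) hx).trans h.1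
  · exact h.2.trans (mul_le_mul_of_nonneg_right (Real.exp_le_exp.2 (by linarith)) hx)

/-- ★ **THE CORE CLAUSE WITH AN OSCILLATING CONSTANT.**  File 17's `core_of_average` wants ONE `c_K` for `P K`-a.e. threshold vector; it suffices that the
sharp sandwich hold a.e. with SOME constant within `η_K` of `c_K` (`|c′ − c_K| ≤ η_K`; the sharp cores `As − shAs` nonnegative a.e.): the AVERAGED cores are then
sandwiched with `c_K` and the width `vol·δ_K + η_K = vol·(δ_K + η_K∕vol)` (`0 < vol`) — the consumer sums `δ + η∕vol`, so a SUMMABLE oscillation of the core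
constant over the box is free.  The located cost (ii) of file 17, priced. [folklore] -/
theorem core_of_average_osc (hvol : 0 < vol)
    (hAi : ∀ K t, |t| ≤ l₀ → ∀ τ ∈ T K, Integrable (fun l => As K l t τ) (P K))
    (hBi : ∀ K t, |t| ≤ l₀ → ∀ τ ∈ T K, Integrable (fun l => Bs K l t τ) (P K))
    (hshAi : ∀ K t, |t| ≤ l₀ → ∀ τ ∈ T K, Integrable (fun l => shAs K l t τ) (P K))
    (hshBi : ∀ K t, |t| ≤ l₀ → ∀ τ ∈ T K, Integrable (fun l => shBs K l t τ) (P K))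
    (hA : ∀ K t, |t| ≤ l₀ → ∀ τ ∈ T K, A K t τ = ∫ l, As K l t τ ∂(P K))
    (hB : ∀ K t, |t| ≤ l₀ → ∀ τ ∈ T K, B K t τ = ∫ l, Bs K l t τ ∂(P K))
    (hshA : ∀ K t, |t| ≤ l₀ → ∀ τ ∈ T K, shA K t τ = ∫ l, shAs K l t τ ∂(P K))
    (hshB : ∀ K t, |t| ≤ l₀ → ∀ τ ∈ T K, shB K t τ = ∫ l, shBs K l t τ ∂(P K))
    (hshleA : ∀ K t, |t| ≤ l₀ → ∀ τ ∈ T K, ∀ᵐ l ∂(P K), shAs K l t τ ≤ As K l t τ)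
    (hcore : ∀ K : ℕ, ∃ c : ℝ, ∀ t : ℝ, |t| ≤ l₀ → ∀ τ ∈ T K \ Bad K t, ∀ᵐ l ∂(P K), ∃ c' : ℝ, |c' - c| ≤ η K ∧
      Real.exp (c' - vol * δ K) * (As K l t τ - shAs K l t τ) ≤ Bs K l t τ - shBs K l t τ ∧
        Bs K l t τ - shBs K l t τ ≤ Real.exp (c' + vol * δ K) * (As K l t τ - shAs K l t τ)) :
    ∀ K : ℕ, ∃ c : ℝ, ∀ t : ℝ, |t| ≤ l₀ → ∀ τ ∈ T K \ Bad K t,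
      Real.exp (c - vol * (δ K + η K / vol)) * (A K t τ - shA K t τ) ≤ B K t τ - shB K t τ ∧
        B K t τ - shB K t τ ≤ Real.exp (c + vol * (δ K + η K / vol)) * (A K t τ - shA K t τ) := by
  refine core_of_average hAi hBi hshAi hshBi hA hB hshA hshB fun K => ?_
  obtain ⟨c, hc⟩ := hcore K
  refine ⟨c, fun t ht τ hτ => ?_⟩
  have hτT : τ ∈ T K := (Finset.mem_sdiff.1 hτ).1
  have hw : vol * (δ K + η K / vol) = vol * δ K + η K := by
    rw [mul_add, mul_div_cancel₀ _ hvol.ne']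
  filter_upwards [hc t ht τ hτ, hshleA K t ht τ hτT] with l hl hle
  obtain ⟨c', hc', hsand⟩ := hl
  rw [hw]
  exact sandwich_of_osc (sub_nonneg.2 hle) hc' hsand

end CoreOsc

end Summit.QuantumFields.YangMills.Theorems.N21ThresholdMixtureTransferCorner

end
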